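import Summits.QuantumAdvantage.QuantumAdvantage.Theorems.SosSandwichPseudoBoundedAAClassicalCornerSpectralDuality
import Summits.QuantumAdvantage.QuantumAdvantage.Theorems.SosSandwichPseudoBoundedAABooleanCorner
import Literature.Computability.QuantumComplexity.AaronsonAmbainisMoments
import HarnessLib

/-!
# Crux `PseudoBoundedAA` (stmt-QuantumAdvantage-15237, route SosSandwich) — classical corner: the `Φ_max` law in the
# crux's own vocabulary, `16·Var[p]² ≤ 4·max_k Φ(t_k) · Σⱼ δ̄ⱼ Infⱼ[p]`

Support file (`--supports stmt-QuantumAdvantage-15237`): the mixture theorem of `…ClassicalCornerSpectralDuality.lean`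
(`sixteen_var_sq_le_four_phiMax_mul`, Fourier-side) restated with the tree's `boolVariance` / `influence` of
`AaronsonAmbainis.lean` (the route items' inline `avg`/`ev` by `rfl`), i.e. in the same currency as the hands' laws
`…ClassicalCornerSensitivityOSSS.sixteen_variance_sq_le_avgSensitivity_mul` (`C₀ = Ī`) and
`…ClassicalCornerQueryOSSS.sixteen_variance_sq_le_sum_queryProb_mul` (`C₀ = Σⱼ δ̄ⱼ`):

* `boolVariance_eq_sum_nonempty_sq` — `Var[p] = Σ_{S≠∅} p̂(S)²` for the cube values of a polynomial;
* **`sixteen_variance_sq_le_four_phiMax_mul`** — if `p` is on the cube a mixture `Σ_k w_k [t_k accepts]` (`w ≥ 0`,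
  `Σ w ≤ 1`) and every tree has spectral constant `Φ(t_k) = Σ_{S≠∅} F̂_k(S)²/δ_{t_k}(S) ≤ M`, then
  `16·Var[p]² ≤ 4M · Σⱼ δ̄ⱼ·Infⱼ[p]`, `δ̄ⱼ = Σ_k w_k #{x : j ∈ t_k.queries x}/2^N`.
  With `not_exists_bilinear_osss` (`sup_t Φ(t) = ∞`, `…L2OSSSNoGoBalanced.lean`) this brackets exactly what the per-tree
  route can give: an absolute `C₀` on every class of trees with bounded `Φ`, and nothing uniform in the depth.

Honest label: calibration inside the classical corner of an open conjecture; no stub, crux or summit is closed.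
Sources: R. O'Donnell, *Analysis of Boolean Functions* (2014) §1.4, §3.4, §8.6; O'Donnell–Saks–Schramm–Servedio,
FOCS 2005, Thm 3.2; S. Aaronson, A. Ambainis, arXiv:0911.0996, Thm 8 and remark.
-/

set_option linter.dupNamespace false

noncomputable section

namespace Summit.QuantumAdvantage.QuantumAdvantage.Theorems.SosSandwich

open Finset Function
open Literature.Computability.Complexity Literature.Computability.QuantumComplexity
open Literature.Computability.Complexity.LowDegree (cubeFourierCoeff)

namespace ClassicalCornerSpectralDuality

variable {N : ℕ}

/-- `Var[p] = Σ_{S≠∅} p̂(S)²` for the cube values `evalBool p` of a real polynomial. [cite: ODonnell2014, §1.4] -/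
theorem boolVariance_eq_sum_nonempty_sq (p : MvPolynomial (Fin N) ℝ) :
    boolVariance p =
      ∑ S ∈ Finset.univ.filter (fun S : Finset (Fin N) => S.Nonempty), cubeFourierCoeff (evalBool p) S ^ 2 := by
  rw [ClassicalCornerSpectralL1.varFourier_eq, boolVariance_eq_avg_sq_sub]
  unfold boolAvg
  rw [sq, Finset.sum_congr rfl fun x _ => (sq (evalBool p x)).symm]

/-- **The `Φ_max` law on the classical corner.**  If the real polynomial `p` is on the cube a mixture
`p(x) = Σ_{k∈s} w_k·[t_k accepts x]` with `w_k ≥ 0`, `Σ w_k ≤ 1`, and every tree's spectral constant satisfies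
`Σ_{S≠∅} F̂_k(S)²/δ_{t_k}(S) ≤ M`, then `16·Var[p]² ≤ 4M · Σⱼ δ̄ⱼ·Infⱼ[p]` with
`δ̄ⱼ = Σ_k w_k #{x : j ∈ t_k.queries x}/2^N`. [cite: ODonnell2014, §8.6] [cite: OdonnellEtAl2005, Thm 3.2] -/
theorem sixteen_variance_sq_le_four_phiMax_mul {ι : Type*} (s : Finset ι) (w : ι → ℝ)
    (hw : ∀ k ∈ s, 0 ≤ w k) (hw1 : ∑ k ∈ s, w k ≤ 1) (t : ι → DecisionTree N) (p : MvPolynomial (Fin N) ℝ)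
    (hp : ∀ x, evalBool p x = ∑ k ∈ s, w k * (if (t k).eval x = true then (1 : ℝ) else 0)) (M : ℝ)
    (hM : ∀ k ∈ s, ∑ S ∈ Finset.univ.filter (fun S : Finset (Fin N) => S.Nonempty),
        cubeFourierCoeff (fun x => if (t k).eval x = true then (1 : ℝ) else 0) S ^ 2 /
          ∑ j ∈ S, ((Finset.univ.filter fun x : Fin N → Bool => j ∈ (t k).queries x).card : ℝ) / (2 : ℝ) ^ N ≤ M) :
    16 * boolVariance p ^ 2 ≤
      4 * M * ∑ j, (∑ k ∈ s, w k *
          (((Finset.univ.filter fun x : Fin N → Bool => j ∈ (t k).queries x).card : ℝ) / (2 : ℝ) ^ N)) *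
        influence j p := by
  have h := sixteen_var_sq_le_four_phiMax_mul s w hw hw1 t
    (fun k x => if (t k).eval x = true then (1 : ℝ) else 0) (fun k x => rfl) (evalBool p) hp M hM
  rw [← boolVariance_eq_sum_nonempty_sq] at h
  refine h.trans (le_of_eq ?_)
  congr 1
  refine Finset.sum_congr rfl fun j _ => ?_
  rw [BooleanCorner.sum_sq_update_eq_influence p j, mul_div_cancel_left₀ _ (by positivity)]

end ClassicalCornerSpectralDuality

end Summit.QuantumAdvantage.QuantumAdvantage.Theorems.SosSandwich

end
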